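import Summits.Langlands.Langlands.Theses.PhantomRMYoshida
import Summits.Langlands.Langlands.Theorems.PhantomRMYoshidaStableYoshidaCongruenceDetCondIdle
import HarnessLib

/-!
# Route `PhantomRMYoshida`, crux `StableYoshidaCongruence` (stmt-Langlands-13640): glue of the
automorphic/Galois split with the MINIMAL hypothesis list (line `automorphic-galois-split`)

Theorems-resident copy (prover-landed, `--supports stmt-Langlands-13640`) of the crux workfile
`Cruxes/StableYoshidaCongruence/StrategistSplitMin.lean` (crux-strategist unit
`cstrat-stmt-Langlands-13640-s1`, 2026-08-17), so that a route edit
`--split StableYoshidaCongruence --into children_min.json --glue-by <decl>` can name a glue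
declaration under `Theorems/` (namespace `Summit.Langlands.Langlands.Theorems.PhantomRMYoshida`).
It does NOT close the crux.  The two children are spelled out verbatim as hypothesis types — they
are byte-identical to the two REGISTERED stubs `stub_stableYoshidaCongruenceIrr` /
`stub_irregularSymplecticLifting` of the skeleton `Cruxes/StableYoshidaCongruence/Lines/automorphic_galois_split.lean`:

* child 1 `StableYoshidaCongruenceIrr` — THE AUTOMORPHIC HALF: the crux with its minimal hypothesis
  list (the idle clauses `det σ' = det σ` and non-conjugacy deleted — consequences of
  `det σ = ε̄⁻¹` and the witness: `detCond_of_det_of_sh` p156186, `nonConj_of_detCond_of_sh`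
  p155497) and its witness hypothesis strengthened to an IRREDUCIBLE witness `∃ ρ, ρ irreducible ∧ Sh ρ`.
* child 2 `IrregularSymplecticLifting` — THE GALOIS HALF: same minimal hypotheses without the
  residual-automorphy decoration `AutGL2 σ`, `AutGL2 σ'`, conclusion the automorphy-free
  `∃ ρ₁, ρ₁ irreducible ∧ Sh ρ₁`.

Theorems: `stableYoshidaCongruence_of_minimalSubs` (THE GLUE, pure logic: child 1 → child 2 → crux);
exactness: `stableYoshidaCongruenceIrrMin_of_stableYoshidaCongruence` (crux → child 1, unconditional)
and `irregularSymplecticLifting_of_KW_of_stableYoshidaCongruence` (`SerreKWAutomorphicGL2 → crux →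
child 2`), packaged as `stableYoshidaCongruence_iff_minimalSubs_of_KW`; and the RE-GLUE TERM
`langlands_of_stableYoshidaCongruenceIrrMin` : `SerreKWAutomorphicGL2 → child 1 →
ResiduallyYoshidaLifting → PhantomRMJunction → Langlands` (the route closes through child 1 alone).
Compared with `…IrrCloses.lean` (p138563, children with the full hypothesis list) the only change is
the hypothesis hygiene of `stableYoshidaCongruence_iff_minimalHyps` (p156186). [folklore]
-/

set_option linter.dupNamespace false -- `Summit.Langlands.Langlands` is the mandated namespace (D-0017)

namespace Summit.Langlands.Langlands.Theorems.PhantomRMYoshida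

open Summit.Langlands.Langlands.Theses.PhantomRMYoshida
open Literature.NumberTheory.GaloisRepresentations Literature.NumberTheory.Automorphic
open IsDedekindDomain
open scoped NumberField
open Summit.Langlands.Langlands.Cruxes.StableYoshidaCongruence.LevelThreeWeierstrassSwitch
  (epsBar Sh AutGL2 AutGL4 DetCond NonConj)

/-- **The glue of the split** `StableYoshidaCongruence ⇐ StableYoshidaCongruenceIrr ∧
IrregularSymplecticLifting`: at fixed data child 2 turns the crux's (possibly reducible) witness into
an irreducible one, which child 1 accepts; the crux's two idle hypotheses and (for child 2) its
`AutGL2` hypotheses are simply not passed on.  Pure logic. [folklore] -/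
theorem stableYoshidaCongruence_of_minimalSubs : (∀ (p : ℕ) [Fact p.Prime], p ≠ 2 → ∀ (k : Type) [Field k] [CharP k p] [IsAlgClosed k] [TopologicalSpace k] [DiscreteTopology k] (red : Valued.integer (PadicAlgCl p) →+* k) (σ σ' : FramedGaloisRep ℚ k 2), let εb : Field.absoluteGaloisGroup ℚ →* (ZMod p)ˣ := (modularCyclotomicCharacter (AlgebraicClosure ℚ) (HasEnoughRootsOfUnity.natCard_rootsOfUnity (AlgebraicClosure ℚ) p)).comp (MulSemiringAction.toRingAut (Field.absoluteGaloisGroup ℚ) (AlgebraicClosure ℚ)); let Sh := fun r : FramedGaloisRep ℚ (PadicAlgCl p) 4 => (r.IsSymplecticWithMultiplierFun (fun g => algebraMap ℚ_[p] (PadicAlgCl p) ((((GaloisRep.cyclotomicCharacter ℚ p g)⁻¹ : ℤ_[p]ˣ) : ℤ_[p]) : ℚ_[p])) ∧ (∀ v : HeightOneSpectrum (𝓞 ℚ), ((p : ℕ) : 𝓞 ℚ) ∈ v.asIdeal → r.IsGreenbergOrdinaryOfShapeAt v ![0, 0, 1, 1] ∧ r.IsResiduallyDistinguishedAt v ![0,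 0, 1, 1]) ∧ (∀ᶠ v : HeightOneSpectrum (𝓞 ℚ) in Filter.cofinite, r.IsUnramifiedAt v ∧ σ.IsUnramifiedAt v ∧ σ'.IsUnramifiedAt v ∧ ∃ (P : Polynomial (Valued.integer (PadicAlgCl p))) (P₁ P₂ : Polynomial k), r.HasFrobCharpolyAt v (P.map (Valued.integer (PadicAlgCl p)).subtype) ∧ σ.HasFrobCharpolyAt v P₁ ∧ σ'.HasFrobCharpolyAt v P₂ ∧ P.map red = P₁ * P₂)); let AutGL2 := fun s : FramedGaloisRep ℚ k 2 => (∀ (hcpt₂ : isCompact_glFiniteIntegralLevel 2 ℚ) (ι : PadicAlgCl p ≃+* ℂ), ∃ π₂ : CuspidalAutomorphicRepData 2 ℚ hcpt₂, π₂.1.IsLAlgebraic ∧ ∀ᶠ v : HeightOneSpectrum (𝓞 ℚ) in Filter.cofinite, ∃ (a : Multiset ℂ) (P : Polynomial (Valued.integer (PadicAlgCl p))) (Pb : Polynomial k), π₂.1.HasSatakeParamAt v a ∧ P.map (Valued.integer (PadicAlgCl p)).subtype = arithFrobPolyOfSatake ι v.residueCard 1 a ∧ s.IsUnramifiedAt v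 ∧ s.HasFrobCharpolyAt v Pb ∧ P.map red = Pb); AutGL2 σ → AutGL2 σ' → σ.toGaloisRep.IsIrreducible → σ'.toGaloisRep.IsIrreducible → (∀ g, FramedRep.det σ g = (Units.map (ZMod.castHom (dvd_refl p) k).toMonoidHom (εb g))⁻¹) → (∃ ρ : FramedGaloisRep ℚ (PadicAlgCl p) 4, ρ.toGaloisRep.IsIrreducible ∧ Sh ρ) → ∀ (hcpt : isCompact_glFiniteIntegralLevel 4 ℚ) (ι : PadicAlgCl p ≃+* ℂ), ∃ ρ₀ : FramedGaloisRep ℚ (PadicAlgCl p) 4, ρ₀.toGaloisRep.IsIrreducible ∧ Sh ρ₀ ∧ (∃ π : CuspidalAutomorphicRepData 4 ℚ hcpt, π.1.IsLAlgebraic ∧ ∀ᶠ v : HeightOneSpectrum (𝓞 ℚ) in Filter.cofinite, ∃ a : Multiset ℂ, π.1.HasSatakeParamAt v a ∧ ρ₀.IsUnramifiedAt v ∧ ρ₀.HasFrobCharpolyAt v (arithFrobPolyOfSatake ι v.residueCard 1 a))) → (∀ (p : ℕ) [Fact p.Prime], p ≠ 2 → ∀ (k : Type) [Field k] [CharP k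 p] [IsAlgClosed k] [TopologicalSpace k] [DiscreteTopology k] (red : Valued.integer (PadicAlgCl p) →+* k) (σ σ' : FramedGaloisRep ℚ k 2), let εb : Field.absoluteGaloisGroup ℚ →* (ZMod p)ˣ := (modularCyclotomicCharacter (AlgebraicClosure ℚ) (HasEnoughRootsOfUnity.natCard_rootsOfUnity (AlgebraicClosure ℚ) p)).comp (MulSemiringAction.toRingAut (Field.absoluteGaloisGroup ℚ) (AlgebraicClosure ℚ)); let Sh := fun r : FramedGaloisRep ℚ (PadicAlgCl p) 4 => (r.IsSymplecticWithMultiplierFun (fun g => algebraMap ℚ_[p] (PadicAlgCl p) ((((GaloisRep.cyclotomicCharacter ℚ p g)⁻¹ : ℤ_[p]ˣ) : ℤ_[p]) : ℚ_[p])) ∧ (∀ v : HeightOneSpectrum (𝓞 ℚ), ((p : ℕ) : 𝓞 ℚ) ∈ v.asIdeal → r.IsGreenbergOrdinaryOfShapeAt v ![0, 0, 1, 1] ∧ r.IsResiduallyDistinguishedAt v ![0, 0, 1, 1]) ∧ (∀ᶠ v : HeightOneSpectrum (𝓞 ℚ) in Filter.cofinite, r.IsUnramifiedAt v ∧ σ.IsUnramifiedAt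 v ∧ σ'.IsUnramifiedAt v ∧ ∃ (P : Polynomial (Valued.integer (PadicAlgCl p))) (P₁ P₂ : Polynomial k), r.HasFrobCharpolyAt v (P.map (Valued.integer (PadicAlgCl p)).subtype) ∧ σ.HasFrobCharpolyAt v P₁ ∧ σ'.HasFrobCharpolyAt v P₂ ∧ P.map red = P₁ * P₂)); σ.toGaloisRep.IsIrreducible → σ'.toGaloisRep.IsIrreducible → (∀ g, FramedRep.det σ g = (Units.map (ZMod.castHom (dvd_refl p) k).toMonoidHom (εb g))⁻¹) → (∃ ρ : FramedGaloisRep ℚ (PadicAlgCl p) 4, Sh ρ) → ∃ ρ₁ : FramedGaloisRep ℚ (PadicAlgCl p) 4, ρ₁.toGaloisRep.IsIrreducible ∧ Sh ρ₁) → Summit.Langlands.Langlands.Theses.PhantomRMYoshida.StableYoshidaCongruence := by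
  intro hA hB p _ hp k _ _ _ _ _ red σ σ' εb Sh AutGL2 h₁ h₂ h₃ h₄ h₅ _h₆ hw hcpt ι
  obtain ⟨ρ₁, hirr₁, hSh₁⟩ := hB p hp k red σ σ' h₃ h₄ (fun g => (h₅ g).1) hw
  exact hA p hp k red σ σ' h₁ h₂ h₃ h₄ (fun g => (h₅ g).1) ⟨ρ₁, hirr₁, hSh₁⟩ hcpt ι

/-- **Exactness, first half (unconditional)**: the crux implies child 1 — an irreducible witness is
a witness, and the two deleted hypotheses are rebuilt from `det σ = ε̄⁻¹` and the witness by the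
landed idle-hypothesis theorems `detCond_of_det_of_sh` (p156186) and `nonConj_of_detCond_of_sh`
(p155497). [folklore] -/
theorem stableYoshidaCongruenceIrrMin_of_stableYoshidaCongruence (h : StableYoshidaCongruence) :
    (∀ (p : ℕ) [Fact p.Prime], p ≠ 2 → ∀ (k : Type) [Field k] [CharP k p] [IsAlgClosed k] [TopologicalSpace k] [DiscreteTopology k] (red : Valued.integer (PadicAlgCl p) →+* k) (σ σ' : Literature.NumberTheory.GaloisRepresentations.FramedGaloisRep ℚ k 2), let εb : Field.absoluteGaloisGroup ℚ →* (ZMod p)ˣ := (modularCyclotomicCharacter (AlgebraicClosure ℚ) (HasEnoughRootsOfUnity.natCard_rootsOfUnity (AlgebraicClosure ℚ) p)).comp (MulSemiringAction.toRingAut (Field.absoluteGaloisGroup ℚ) (AlgebraicClosure ℚ)); let Sh := fun r : Literature.NumberTheory.GaloisRepresentations.FramedGaloisRep ℚ (PadicAlgCl p) 4 => (r.IsSymplecticWithMultiplierFun (fun g => algebraMap ℚ_[p] (PadicAlgCl p) ((((Literature.NumberTheory.GaloisRepresentations.GaloisRep.cyclotomicCharacter ℚ p g)⁻¹ : ℤ_[p]ˣ)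 : ℤ_[p]) : ℚ_[p])) ∧ (∀ v : IsDedekindDomain.HeightOneSpectrum (NumberField.RingOfIntegers ℚ), ((p : ℕ) : NumberField.RingOfIntegers ℚ) ∈ v.asIdeal → r.IsGreenbergOrdinaryOfShapeAt v ![0, 0, 1, 1] ∧ r.IsResiduallyDistinguishedAt v ![0, 0, 1, 1]) ∧ (∀ᶠ v : IsDedekindDomain.HeightOneSpectrum (NumberField.RingOfIntegers ℚ) in Filter.cofinite, r.IsUnramifiedAt v ∧ σ.IsUnramifiedAt v ∧ σ'.IsUnramifiedAt v ∧ ∃ (P : Polynomial (Valued.integer (PadicAlgCl p))) (P₁ P₂ : Polynomial k), r.HasFrobCharpolyAt v (P.map (Valued.integer (PadicAlgCl p)).subtype) ∧ σ.HasFrobCharpolyAt v P₁ ∧ σ'.HasFrobCharpolyAt v P₂ ∧ P.map red = P₁ * P₂)); let AutGL2 := fun s : Literature.NumberTheory.GaloisRepresentations.FramedGaloisRep ℚ k 2 => (∀ (hcpt₂ : Literature.NumberTheory.Automorphic.isCompact_glFiniteIntegralLevel 2 ℚ) (ι : PadicAlgCl p ≃+* ℂ), ∃ π₂ : Literature.NumberTheory.Automorphic.CuspidalAutomorphicRepData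 2 ℚ hcpt₂, π₂.1.IsLAlgebraic ∧ ∀ᶠ v : IsDedekindDomain.HeightOneSpectrum (NumberField.RingOfIntegers ℚ) in Filter.cofinite, ∃ (a : Multiset ℂ) (P : Polynomial (Valued.integer (PadicAlgCl p))) (Pb : Polynomial k), π₂.1.HasSatakeParamAt v a ∧ P.map (Valued.integer (PadicAlgCl p)).subtype = Literature.NumberTheory.Automorphic.arithFrobPolyOfSatake ι v.residueCard 1 a ∧ s.IsUnramifiedAt v ∧ s.HasFrobCharpolyAt v Pb ∧ P.map red = Pb); AutGL2 σ → AutGL2 σ' → σ.toGaloisRep.IsIrreducible → σ'.toGaloisRep.IsIrreducible → (∀ g, Literature.NumberTheory.GaloisRepresentations.FramedRep.det σ g = (Units.map (ZMod.castHom (dvd_refl p) k).toMonoidHom (εb g))⁻¹) → (∃ ρ : Literature.NumberTheory.GaloisRepresentations.FramedGaloisRep ℚ (PadicAlgCl p) 4, ρ.toGaloisRep.IsIrreducible ∧ Sh ρ) → ∀ (hcpt : Literature.NumberTheory.Automorphic.isCompact_glFiniteIntegralLevel 4 ℚ) (ι : PadicAlgCl p ≃+* ℂ), ∃ ρ₀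 : Literature.NumberTheory.GaloisRepresentations.FramedGaloisRep ℚ (PadicAlgCl p) 4, ρ₀.toGaloisRep.IsIrreducible ∧ Sh ρ₀ ∧ (∃ π : Literature.NumberTheory.Automorphic.CuspidalAutomorphicRepData 4 ℚ hcpt, π.1.IsLAlgebraic ∧ ∀ᶠ v : IsDedekindDomain.HeightOneSpectrum (NumberField.RingOfIntegers ℚ) in Filter.cofinite, ∃ a : Multiset ℂ, π.1.HasSatakeParamAt v a ∧ ρ₀.IsUnramifiedAt v ∧ ρ₀.HasFrobCharpolyAt v (Literature.NumberTheory.Automorphic.arithFrobPolyOfSatake ι v.residueCard 1 a))) := by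
  intro p _ hp k _ _ _ _ _ red σ σ' εb Sh AutGL2 h₁ h₂ h₃ h₄ hdet hw hcpt ι
  obtain ⟨ρ, hirr, hSh⟩ := hw
  have hdc : DetCond p σ σ' := detCond_of_det_of_sh hdet hSh
  have hnc : NonConj σ σ' := nonConj_of_detCond_of_sh hp hdc hSh
  exact h p hp k red σ σ' h₁ h₂ h₃ h₄ hdc hnc ⟨ρ, hSh⟩ hcpt ι

/-- **Exactness, second half (modulo the route's KW gate item)**: `SerreKWAutomorphicGL2` and the
crux imply child 2 — rebuild the idle hypotheses as above, get oddness for free from `det σ = ε̄⁻¹`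
(`isOdd_of_det_eq_inv_epsBar`, p138563), feed KW for the two `AutGL2` hypotheses, instantiate the
crux's conclusion at the inhabited `hcpt`, `ι` and forget automorphy. [folklore] -/
theorem irregularSymplecticLifting_of_KW_of_stableYoshidaCongruence (hKW : SerreKWAutomorphicGL2)
    (h : StableYoshidaCongruence) :
    (∀ (p : ℕ) [Fact p.Prime], p ≠ 2 → ∀ (k : Type) [Field k] [CharP k p] [IsAlgClosed k] [TopologicalSpace k] [DiscreteTopology k] (red : Valued.integer (PadicAlgCl p) →+* k) (σ σ' : Literature.NumberTheory.GaloisRepresentations.FramedGaloisRep ℚ k 2), let εb : Field.absoluteGaloisGroup ℚ →* (ZMod p)ˣ := (modularCyclotomicCharacter (AlgebraicClosure ℚ) (HasEnoughRootsOfUnity.natCard_rootsOfUnity (AlgebraicClosure ℚ) p)).comp (MulSemiringAction.toRingAut (Field.absoluteGaloisGroup ℚ) (AlgebraicClosure ℚ)); let Sh := fun r : Literature.NumberTheory.GaloisRepresentations.FramedGaloisRep ℚ (PadicAlgCl p) 4 => (r.IsSymplecticWithMultiplierFun (fun g => algebraMap ℚ_[p] (PadicAlgCl p) ((((Literature.NumberTheory.GaloisRepresentations.GaloisRep.cyclotomicCharacter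 ℚ p g)⁻¹ : ℤ_[p]ˣ) : ℤ_[p]) : ℚ_[p])) ∧ (∀ v : IsDedekindDomain.HeightOneSpectrum (NumberField.RingOfIntegers ℚ), ((p : ℕ) : NumberField.RingOfIntegers ℚ) ∈ v.asIdeal → r.IsGreenbergOrdinaryOfShapeAt v ![0, 0, 1, 1] ∧ r.IsResiduallyDistinguishedAt v ![0, 0, 1, 1]) ∧ (∀ᶠ v : IsDedekindDomain.HeightOneSpectrum (NumberField.RingOfIntegers ℚ) in Filter.cofinite, r.IsUnramifiedAt v ∧ σ.IsUnramifiedAt v ∧ σ'.IsUnramifiedAt v ∧ ∃ (P : Polynomial (Valued.integer (PadicAlgCl p))) (P₁ P₂ : Polynomial k), r.HasFrobCharpolyAt v (P.map (Valued.integer (PadicAlgCl p)).subtype) ∧ σ.HasFrobCharpolyAt v P₁ ∧ σ'.HasFrobCharpolyAt v P₂ ∧ P.map red = P₁ * P₂)); σ.toGaloisRep.IsIrreducible → σ'.toGaloisRep.IsIrreducible → (∀ g, Literature.NumberTheory.GaloisRepresentations.FramedRep.det σ g = (Units.map (ZMod.castHom (dvd_refl p) k).toMonoidHom (εb g))⁻¹)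 → (∃ ρ : Literature.NumberTheory.GaloisRepresentations.FramedGaloisRep ℚ (PadicAlgCl p) 4, Sh ρ) → ∃ ρ₁ : Literature.NumberTheory.GaloisRepresentations.FramedGaloisRep ℚ (PadicAlgCl p) 4, ρ₁.toGaloisRep.IsIrreducible ∧ Sh ρ₁) := by
  intro p _ hp k _ _ _ _ _ red σ σ' εb Sh h₃ h₄ hdet hw
  obtain ⟨ρ, hSh⟩ := hw
  have hdc : DetCond p σ σ' := detCond_of_det_of_sh hdet hSh
  have hnc : NonConj σ σ' := nonConj_of_detCond_of_sh hp hdc hSh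
  have hodd := isOdd_of_det_eq_inv_epsBar hdc
  obtain ⟨ι⟩ :=
    Literature.NumberTheory.GaloisRepresentations.NumberField.nonempty_algebraicClosure_padic_ringEquiv_complex p
  obtain ⟨ρ₀, hirr, hSh₀, -⟩ :=
    h p hp k red σ σ' (hKW p k red σ hodd.1 h₃) (hKW p k red σ' hodd.2 h₄) h₃ h₄ hdc hnc ⟨ρ, hSh⟩
      (isCompact_glFiniteIntegralLevel_holds 4 ℚ) ι
  exact ⟨ρ₀, hirr, hSh₀⟩

/-- **The split is exact modulo the KW gate**: given `SerreKWAutomorphicGL2` (the first hypothesis of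
the route's `closes`), `StableYoshidaCongruence ↔ child 1 ∧ child 2`. [folklore] -/
theorem stableYoshidaCongruence_iff_minimalSubs_of_KW (hKW : SerreKWAutomorphicGL2) :
    StableYoshidaCongruence ↔ ((∀ (p : ℕ) [Fact p.Prime], p ≠ 2 → ∀ (k : Type) [Field k] [CharP k p] [IsAlgClosed k] [TopologicalSpace k] [DiscreteTopology k] (red : Valued.integer (PadicAlgCl p) →+* k) (σ σ' : Literature.NumberTheory.GaloisRepresentations.FramedGaloisRep ℚ k 2), let εb : Field.absoluteGaloisGroup ℚ →* (ZMod p)ˣ := (modularCyclotomicCharacter (AlgebraicClosure ℚ) (HasEnoughRootsOfUnity.natCard_rootsOfUnity (AlgebraicClosure ℚ) p)).comp (MulSemiringAction.toRingAut (Field.absoluteGaloisGroup ℚ) (AlgebraicClosure ℚ)); let Sh := fun r : Literature.NumberTheory.GaloisRepresentations.FramedGaloisRep ℚ (PadicAlgCl p) 4 => (r.IsSymplecticWithMultiplierFun (fun g => algebraMap ℚ_[p] (PadicAlgCl p) ((((Literature.NumberTheory.GaloisRepresentations.GaloisRep.cyclotomicCharacter ℚ p g)⁻¹ : ℤ_[p]ˣ)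 : ℤ_[p]) : ℚ_[p])) ∧ (∀ v : IsDedekindDomain.HeightOneSpectrum (NumberField.RingOfIntegers ℚ), ((p : ℕ) : NumberField.RingOfIntegers ℚ) ∈ v.asIdeal → r.IsGreenbergOrdinaryOfShapeAt v ![0, 0, 1, 1] ∧ r.IsResiduallyDistinguishedAt v ![0, 0, 1, 1]) ∧ (∀ᶠ v : IsDedekindDomain.HeightOneSpectrum (NumberField.RingOfIntegers ℚ) in Filter.cofinite, r.IsUnramifiedAt v ∧ σ.IsUnramifiedAt v ∧ σ'.IsUnramifiedAt v ∧ ∃ (P : Polynomial (Valued.integer (PadicAlgCl p))) (P₁ P₂ : Polynomial k), r.HasFrobCharpolyAt v (P.map (Valued.integer (PadicAlgCl p)).subtype) ∧ σ.HasFrobCharpolyAt v P₁ ∧ σ'.HasFrobCharpolyAt v P₂ ∧ P.map red = P₁ * P₂)); let AutGL2 := fun s : Literature.NumberTheory.GaloisRepresentations.FramedGaloisRep ℚ k 2 => (∀ (hcpt₂ : Literature.NumberTheory.Automorphic.isCompact_glFiniteIntegralLevel 2 ℚ) (ι : PadicAlgCl p ≃+* ℂ), ∃ π₂ : Literature.NumberTheory.Automorphic.CuspidalAutomorphicRepData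 2 ℚ hcpt₂, π₂.1.IsLAlgebraic ∧ ∀ᶠ v : IsDedekindDomain.HeightOneSpectrum (NumberField.RingOfIntegers ℚ) in Filter.cofinite, ∃ (a : Multiset ℂ) (P : Polynomial (Valued.integer (PadicAlgCl p))) (Pb : Polynomial k), π₂.1.HasSatakeParamAt v a ∧ P.map (Valued.integer (PadicAlgCl p)).subtype = Literature.NumberTheory.Automorphic.arithFrobPolyOfSatake ι v.residueCard 1 a ∧ s.IsUnramifiedAt v ∧ s.HasFrobCharpolyAt v Pb ∧ P.map red = Pb); AutGL2 σ → AutGL2 σ' → σ.toGaloisRep.IsIrreducible → σ'.toGaloisRep.IsIrreducible → (∀ g, Literature.NumberTheory.GaloisRepresentations.FramedRep.det σ g = (Units.map (ZMod.castHom (dvd_refl p) k).toMonoidHom (εb g))⁻¹) → (∃ ρ : Literature.NumberTheory.GaloisRepresentations.FramedGaloisRep ℚ (PadicAlgCl p) 4, ρ.toGaloisRep.IsIrreducible ∧ Sh ρ) → ∀ (hcpt : Literature.NumberTheory.Automorphic.isCompact_glFiniteIntegralLevel 4 ℚ) (ι : PadicAlgCl p ≃+* ℂ), ∃ ρ₀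 : Literature.NumberTheory.GaloisRepresentations.FramedGaloisRep ℚ (PadicAlgCl p) 4, ρ₀.toGaloisRep.IsIrreducible ∧ Sh ρ₀ ∧ (∃ π : Literature.NumberTheory.Automorphic.CuspidalAutomorphicRepData 4 ℚ hcpt, π.1.IsLAlgebraic ∧ ∀ᶠ v : IsDedekindDomain.HeightOneSpectrum (NumberField.RingOfIntegers ℚ) in Filter.cofinite, ∃ a : Multiset ℂ, π.1.HasSatakeParamAt v a ∧ ρ₀.IsUnramifiedAt v ∧ ρ₀.HasFrobCharpolyAt v (Literature.NumberTheory.Automorphic.arithFrobPolyOfSatake ι v.residueCard 1 a))) ∧ (∀ (p : ℕ) [Fact p.Prime], p ≠ 2 → ∀ (k : Type) [Field k] [CharP k p] [IsAlgClosed k] [TopologicalSpace k] [DiscreteTopology k] (red : Valued.integer (PadicAlgCl p) →+* k) (σ σ' : Literature.NumberTheory.GaloisRepresentations.FramedGaloisRep ℚ k 2), let εb : Field.absoluteGaloisGroup ℚ →* (ZMod p)ˣ := (modularCyclotomicCharacter (AlgebraicClosure ℚ) (HasEnoughRootsOfUnity.natCard_rootsOfUnity (AlgebraicClosure ℚ)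 p)).comp (MulSemiringAction.toRingAut (Field.absoluteGaloisGroup ℚ) (AlgebraicClosure ℚ)); let Sh := fun r : Literature.NumberTheory.GaloisRepresentations.FramedGaloisRep ℚ (PadicAlgCl p) 4 => (r.IsSymplecticWithMultiplierFun (fun g => algebraMap ℚ_[p] (PadicAlgCl p) ((((Literature.NumberTheory.GaloisRepresentations.GaloisRep.cyclotomicCharacter ℚ p g)⁻¹ : ℤ_[p]ˣ) : ℤ_[p]) : ℚ_[p])) ∧ (∀ v : IsDedekindDomain.HeightOneSpectrum (NumberField.RingOfIntegers ℚ), ((p : ℕ) : NumberField.RingOfIntegers ℚ) ∈ v.asIdeal → r.IsGreenbergOrdinaryOfShapeAt v ![0, 0, 1, 1] ∧ r.IsResiduallyDistinguishedAt v ![0, 0, 1, 1]) ∧ (∀ᶠ v : IsDedekindDomain.HeightOneSpectrum (NumberField.RingOfIntegers ℚ) in Filter.cofinite, r.IsUnramifiedAt v ∧ σ.IsUnramifiedAt v ∧ σ'.IsUnramifiedAt v ∧ ∃ (P : Polynomial (Valued.integer (PadicAlgCl p))) (P₁ P₂ : Polynomial k), r.HasFrobCharpolyAt v (P.map (Valued.integer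 (PadicAlgCl p)).subtype) ∧ σ.HasFrobCharpolyAt v P₁ ∧ σ'.HasFrobCharpolyAt v P₂ ∧ P.map red = P₁ * P₂)); σ.toGaloisRep.IsIrreducible → σ'.toGaloisRep.IsIrreducible → (∀ g, Literature.NumberTheory.GaloisRepresentations.FramedRep.det σ g = (Units.map (ZMod.castHom (dvd_refl p) k).toMonoidHom (εb g))⁻¹) → (∃ ρ : Literature.NumberTheory.GaloisRepresentations.FramedGaloisRep ℚ (PadicAlgCl p) 4, Sh ρ) → ∃ ρ₁ : Literature.NumberTheory.GaloisRepresentations.FramedGaloisRep ℚ (PadicAlgCl p) 4, ρ₁.toGaloisRep.IsIrreducible ∧ Sh ρ₁)) :=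
  ⟨fun h => ⟨stableYoshidaCongruenceIrrMin_of_stableYoshidaCongruence h,
      irregularSymplecticLifting_of_KW_of_stableYoshidaCongruence hKW h⟩,
    fun h => stableYoshidaCongruence_of_minimalSubs h.1 h.2⟩

/-- **Re-glue term for the tenure planner**: the route's deciding chain closes through CHILD 1 ALONE
— `SerreKWAutomorphicGL2 → StableYoshidaCongruenceIrr → ResiduallyYoshidaLifting → PhantomRMJunction →
Langlands` (the sector's own `ρ` is irreducible; reduce to `langlands_of_stableYoshidaCongruenceIrr`,
p138563, by re-inserting the idle hypotheses).  Child 2 is not load-bearing. [folklore] -/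
theorem langlands_of_stableYoshidaCongruenceIrrMin (hKW : SerreKWAutomorphicGL2)
    (hA : (∀ (p : ℕ) [Fact p.Prime], p ≠ 2 → ∀ (k : Type) [Field k] [CharP k p] [IsAlgClosed k] [TopologicalSpace k] [DiscreteTopology k] (red : Valued.integer (PadicAlgCl p) →+* k) (σ σ' : Literature.NumberTheory.GaloisRepresentations.FramedGaloisRep ℚ k 2), let εb : Field.absoluteGaloisGroup ℚ →* (ZMod p)ˣ := (modularCyclotomicCharacter (AlgebraicClosure ℚ) (HasEnoughRootsOfUnity.natCard_rootsOfUnity (AlgebraicClosure ℚ) p)).comp (MulSemiringAction.toRingAut (Field.absoluteGaloisGroup ℚ) (AlgebraicClosure ℚ)); let Sh := fun r : Literature.NumberTheory.GaloisRepresentations.FramedGaloisRep ℚ (PadicAlgCl p) 4 => (r.IsSymplecticWithMultiplierFun (fun g => algebraMap ℚ_[p] (PadicAlgCl p) ((((Literature.NumberTheory.GaloisRepresentations.GaloisRep.cyclotomicCharacter ℚ p g)⁻¹ : ℤ_[p]ˣ) : ℤ_[p]) : ℚ_[p])) ∧ (∀ v : IsDedekindDomain.HeightOneSpectrum (NumberField.RingOfIntegers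 ℚ), ((p : ℕ) : NumberField.RingOfIntegers ℚ) ∈ v.asIdeal → r.IsGreenbergOrdinaryOfShapeAt v ![0, 0, 1, 1] ∧ r.IsResiduallyDistinguishedAt v ![0, 0, 1, 1]) ∧ (∀ᶠ v : IsDedekindDomain.HeightOneSpectrum (NumberField.RingOfIntegers ℚ) in Filter.cofinite, r.IsUnramifiedAt v ∧ σ.IsUnramifiedAt v ∧ σ'.IsUnramifiedAt v ∧ ∃ (P : Polynomial (Valued.integer (PadicAlgCl p))) (P₁ P₂ : Polynomial k), r.HasFrobCharpolyAt v (P.map (Valued.integer (PadicAlgCl p)).subtype) ∧ σ.HasFrobCharpolyAt v P₁ ∧ σ'.HasFrobCharpolyAt v P₂ ∧ P.map red = P₁ * P₂)); let AutGL2 := fun s : Literature.NumberTheory.GaloisRepresentations.FramedGaloisRep ℚ k 2 => (∀ (hcpt₂ : Literature.NumberTheory.Automorphic.isCompact_glFiniteIntegralLevel 2 ℚ) (ι : PadicAlgCl p ≃+* ℂ), ∃ π₂ : Literature.NumberTheory.Automorphic.CuspidalAutomorphicRepData 2 ℚ hcpt₂, π₂.1.IsLAlgebraic ∧ ∀ᶠ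 v : IsDedekindDomain.HeightOneSpectrum (NumberField.RingOfIntegers ℚ) in Filter.cofinite, ∃ (a : Multiset ℂ) (P : Polynomial (Valued.integer (PadicAlgCl p))) (Pb : Polynomial k), π₂.1.HasSatakeParamAt v a ∧ P.map (Valued.integer (PadicAlgCl p)).subtype = Literature.NumberTheory.Automorphic.arithFrobPolyOfSatake ι v.residueCard 1 a ∧ s.IsUnramifiedAt v ∧ s.HasFrobCharpolyAt v Pb ∧ P.map red = Pb); AutGL2 σ → AutGL2 σ' → σ.toGaloisRep.IsIrreducible → σ'.toGaloisRep.IsIrreducible → (∀ g, Literature.NumberTheory.GaloisRepresentations.FramedRep.det σ g = (Units.map (ZMod.castHom (dvd_refl p) k).toMonoidHom (εb g))⁻¹) → (∃ ρ : Literature.NumberTheory.GaloisRepresentations.FramedGaloisRep ℚ (PadicAlgCl p) 4, ρ.toGaloisRep.IsIrreducible ∧ Sh ρ) → ∀ (hcpt : Literature.NumberTheory.Automorphic.isCompact_glFiniteIntegralLevel 4 ℚ) (ι : PadicAlgCl p ≃+* ℂ), ∃ ρ₀ : Literature.NumberTheory.GaloisRepresentations.FramedGaloisRep ℚ (PadicAlgCl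 p) 4, ρ₀.toGaloisRep.IsIrreducible ∧ Sh ρ₀ ∧ (∃ π : Literature.NumberTheory.Automorphic.CuspidalAutomorphicRepData 4 ℚ hcpt, π.1.IsLAlgebraic ∧ ∀ᶠ v : IsDedekindDomain.HeightOneSpectrum (NumberField.RingOfIntegers ℚ) in Filter.cofinite, ∃ a : Multiset ℂ, π.1.HasSatakeParamAt v a ∧ ρ₀.IsUnramifiedAt v ∧ ρ₀.HasFrobCharpolyAt v (Literature.NumberTheory.Automorphic.arithFrobPolyOfSatake ι v.residueCard 1 a))))
    (hL : ResiduallyYoshidaLifting) (hJ : PhantomRMJunction) : _root_.Langlands :=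
  langlands_of_stableYoshidaCongruenceIrr hKW
    (fun p _ hp k _ _ _ _ _ red σ σ' h₁ h₂ h₃ h₄ h₅ _h₆ hw hcpt ι =>
      hA p hp k red σ σ' h₁ h₂ h₃ h₄ (fun g => (h₅ g).1) hw hcpt ι)
    hL hJ

end Summit.Langlands.Langlands.Theorems.PhantomRMYoshida
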